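import Mathlib
import Literature.LinearAlgebra.FreeModule.SubmodulePID
import HarnessLib

/-!
# May 1972 — abelian groups that are "finite-by-free"

Group-theoretic lemmas for the proof of `May1972_units_fg_field_charP` (Karpilovsky 1988,
Thm 4.5.1; W. May 1972): the multiplicative group of a field finitely generated over `𝔽_p` is
(finite cyclic) × (free abelian).  The proof transports through field towers the property

  `Good A` : there is an additive map `f : A →+ (S →₀ ℤ)` into a free `ℤ`-module with FINITE kernel

of an additive abelian group `A` (for `A = Additive Eˣ` this says: the torsion of `Eˣ` is finite
and `Eˣ / torsion` embeds in — hence, subgroups of free abelian groups being free, is — a free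
abelian group; cf. Karpilovsky's "free modulo torsion", §4.5 p. 149).  We never name the property;
every statement spells it out.

* `free_of_injective` : a group embedding in a free `ℤ`-module is free (Hungerford IV.6.1, from
  `Literature.LinearAlgebra.FreeModule.SubmodulePID`).
* `exists_section` : a map onto (its range in) a free module has a section (free ⇒ projective).
* `good_of_injective`, `good_of_extension` : `Good` descends along injections and is stable under
  extensions `0 → H → A → free`.
* `units_mulEquiv_of_finite_ker` : for `A = Additive Eˣ`, `E` a field, `Good A` gives
  `Eˣ ≃* Multiplicative (ZMod n) × Multiplicative (FreeAbelianGroup ι)` (finite subgroups of `Eˣ`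
  are cyclic).

These are the abstract-group steps of Karpilovsky's proof of Thm 4.1.21/4.5.1 ("the image of `ψ`
is a free abelian group", "`E* ≅ W × A`"), isolated so that the field-theoretic files only produce
divisor maps.
-/

namespace Literature.NumberTheory.DiophantineGeometry

namespace May1972

open Function

universe u v w

/-- An additive group that embeds into a free `ℤ`-module is a free `ℤ`-module (subgroups of free
abelian groups are free; Hungerford 1974, Thm IV.6.1, via
`Submodule.free_of_isPrincipalIdealRing`). [cite: Hungerford1974, Ch. IV Thm. 6.1] -/
theorem free_of_injective {A : Type u} {B : Type v} [AddCommGroup A] [AddCommGroup B]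
    [Module.Free ℤ B] (f : A →+ B) (hf : Injective f) : Module.Free ℤ A := by
  haveI := Submodule.free_of_isPrincipalIdealRing (R := ℤ) (LinearMap.range f.toIntLinearMap)
  exact Module.Free.of_equiv (LinearEquiv.ofInjective f.toIntLinearMap hf).symm

/-- A `ℤ`-linear map into a free `ℤ`-module admits a section over its range (the range is free,
hence projective). [folklore] -/
theorem exists_section {A : Type u} {M : Type v} [AddCommGroup A] [AddCommGroup M]
    [Module.Free ℤ M] (g : A →ₗ[ℤ] M) :
    ∃ s : LinearMap.range g →ₗ[ℤ] A, g.rangeRestrict ∘ₗ s = LinearMap.id := by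
  haveI : Module.Free ℤ (LinearMap.range g) := Submodule.free_of_isPrincipalIdealRing _
  exact Module.projective_lifting_property g.rangeRestrict LinearMap.id
    (LinearMap.surjective_rangeRestrict g)

/-- `Good` descends along injective maps: if `A ↪ B` and `B` maps to a free `ℤ`-module with
finite kernel, so does `A`. [folklore] -/
theorem good_of_injective {A : Type u} {B : Type v} [AddCommGroup A] [AddCommGroup B]
    (φ : A →+ B) (hφ : Injective φ)
    (h : ∃ (S : Type w) (f : B →+ (S →₀ ℤ)), Finite f.ker) :
    ∃ (S : Type w) (f : A →+ (S →₀ ℤ)), Finite f.ker := by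
  obtain ⟨S, f, hf⟩ := h
  refine ⟨S, f.comp φ, ?_⟩
  refine Finite.of_injective (fun x : (f.comp φ).ker => (⟨φ x, ?_⟩ : f.ker)) ?_
  · have hx := x.2
    rw [AddMonoidHom.mem_ker] at hx ⊢
    simpa using hx
  · intro x y hxy
    apply Subtype.ext
    apply hφ
    simpa using congrArg Subtype.val hxy

/-- `Good` is stable under extensions by a free quotient: if `g : A → (S →₀ ℤ)` has kernel
(the image of) `H` and `H` maps to a free `ℤ`-module with finite kernel, then so does `A`
(split `A ≅ ker g × range g` by `exists_section`). [folklore] -/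
theorem good_of_extension {A : Type u} {H : Type v} [AddCommGroup A] [AddCommGroup H]
    {S : Type w} (g : A →+ (S →₀ ℤ)) (ι : H →+ A) (hι : Injective ι)
    (hker : ∀ a, g a = 0 → a ∈ ι.range)
    (hH : ∃ (T : Type w) (f : H →+ (T →₀ ℤ)), Finite f.ker) :
    ∃ (U : Type w) (F : A →+ (U →₀ ℤ)), Finite F.ker := by
  obtain ⟨T, f, hf⟩ := hH
  obtain ⟨s, hs⟩ := exists_section g.toIntLinearMap
  -- the retraction `r = id - s ∘ g` onto `ker g`
  let r : A →ₗ[ℤ] A := LinearMap.id - s ∘ₗ g.toIntLinearMap.rangeRestrict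
  have hgs : ∀ y : LinearMap.range g.toIntLinearMap, g (s y) = y := by
    intro y
    have h1 := LinearMap.congr_fun hs y
    rw [LinearMap.comp_apply, LinearMap.id_apply] at h1
    exact congrArg Subtype.val h1
  have hr_ker : ∀ a, g (r a) = 0 := by
    intro a
    have h1 : r a = a - s (g.toIntLinearMap.rangeRestrict a) := rfl
    rw [h1, map_sub, hgs, LinearMap.codRestrict_apply, AddMonoidHom.coe_toIntLinearMap, sub_self]
  have hr_id : ∀ a, g a = 0 → r a = a := by
    intro a ha
    have h0 : g.toIntLinearMap.rangeRestrict a = 0 := by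
      apply Subtype.ext
      show g a = 0
      exact ha
    show a - s (g.toIntLinearMap.rangeRestrict a) = a
    rw [h0, map_zero, sub_zero]
  -- `ρ : A → H`, `ι ∘ ρ = r`
  let e : H ≃+ ι.range := AddMonoidHom.ofInjective hι
  have hr_range : ∀ a, r a ∈ ι.range := fun a => hker _ (hr_ker a)
  let ρ : A →+ H := e.symm.toAddMonoidHom.comp (r.toAddMonoidHom.codRestrict ι.range hr_range)
  have hιρ : ∀ a, ι (ρ a) = r a := by
    intro a
    have : ((e (ρ a) : ι.range) : A) = ι (ρ a) := AddMonoidHom.ofInjective_apply hι (x := ρ a)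
    rw [← this]
    simp [ρ]
  -- the combined map
  let F : A →+ (T ⊕ S →₀ ℤ) :=
    (Finsupp.sumFinsuppAddEquivProdFinsupp (M := ℤ) (α := T) (β := S)).symm.toAddMonoidHom.comp
      ((f.comp ρ).prod g)
  refine ⟨T ⊕ S, F, ?_⟩
  have hF : ∀ a, F a = 0 ↔ f (ρ a) = 0 ∧ g a = 0 := by
    intro a
    simp only [F, AddMonoidHom.coe_comp, AddEquiv.coe_toAddMonoidHom, Function.comp_apply,
      EmbeddingLike.map_eq_zero_iff, AddMonoidHom.prod_apply, Prod.mk_eq_zero]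
  refine Finite.of_injective (fun x : F.ker => (⟨ρ x, ?_⟩ : f.ker)) ?_
  · have hx := (hF x).1 x.2
    exact hx.1
  · intro x y hxy
    have hx := (hF x).1 x.2
    have hy := (hF y).1 y.2
    have h1 : ρ x = ρ y := congrArg Subtype.val hxy
    apply Subtype.ext
    calc (x : A) = r x := (hr_id x hx.2).symm
      _ = ι (ρ x) := (hιρ x).symm
      _ = ι (ρ y) := by rw [h1]
      _ = r y := hιρ y
      _ = y := hr_id y hy.2

/-- Splitting off the kernel: a `ℤ`-linear map `g` into a free `ℤ`-module splits its source as
`ker g × range g` (the range is free, hence projective; Karpilovsky 1988, §4.5 p. 149: "`G` is free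
modulo torsion iff `G = t(G) × A` with `A` free"). [cite: Karpilovsky1988, §4.5 (p. 149)] -/
theorem nonempty_linearEquiv_ker_prod_range {A : Type u} {M : Type v} [AddCommGroup A]
    [AddCommGroup M] [Module.Free ℤ M] (g : A →ₗ[ℤ] M) :
    Nonempty (A ≃ₗ[ℤ] LinearMap.ker g × LinearMap.range g) := by
  obtain ⟨s, hs⟩ := exists_section g
  have hgs : ∀ y : LinearMap.range g, g.rangeRestrict (s y) = y := fun y =>
    LinearMap.congr_fun hs y
  let r : A →ₗ[ℤ] A := LinearMap.id - s ∘ₗ g.rangeRestrict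
  have hr : ∀ a, r a ∈ LinearMap.ker g := by
    intro a
    rw [LinearMap.mem_ker]
    have h1 : r a = a - s (g.rangeRestrict a) := rfl
    have h2 : g (s (g.rangeRestrict a)) = g a := congrArg Subtype.val (hgs (g.rangeRestrict a))
    rw [h1, map_sub, h2, sub_self]
  let φ : A →ₗ[ℤ] LinearMap.ker g × LinearMap.range g :=
    LinearMap.prod (LinearMap.codRestrict _ r hr) g.rangeRestrict
  let ψ : LinearMap.ker g × LinearMap.range g →ₗ[ℤ] A :=
    (LinearMap.ker g).subtype.coprod s
  refine ⟨LinearEquiv.ofLinear φ ψ ?_ ?_⟩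
  · apply LinearMap.ext
    rintro ⟨k, y⟩
    have hk : g.rangeRestrict (k : A) = 0 := by
      apply Subtype.ext
      show g k = 0
      exact k.2
    have hφψ2 : g.rangeRestrict ((k : A) + s y) = y := by
      rw [map_add, hk, hgs, zero_add]
    refine Prod.ext ?_ ?_
    · apply Subtype.ext
      show ((k : A) + s y) - s (g.rangeRestrict ((k : A) + s y)) = k
      rw [hφψ2, add_sub_cancel_right]
    · show g.rangeRestrict ((k : A) + s y) = y
      exact hφψ2
  · apply LinearMap.ext
    intro a
    show (a - s (g.rangeRestrict a)) + s (g.rangeRestrict a) = a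
    rw [sub_add_cancel]

/-- **Packaging for unit groups** (Karpilovsky 1988, Thm 4.5.1, last step, p. 150: "`F₁*` is
cyclic … `E* ≅ W × A`"): if `Additive Eˣ`, `E` a field, maps to a free `ℤ`-module with finite
kernel, then `Eˣ ≃* Multiplicative (ZMod n) × Multiplicative (FreeAbelianGroup ι)` with `0 < n`
(the kernel is a finite subgroup of `Eˣ`, hence cyclic; the image is a subgroup of a free abelian
group, hence free). [cite: Karpilovsky1988, Thm 4.5.1] -/
theorem units_mulEquiv_of_finite_ker {E : Type u} [Field E] {S : Type v}
    (f : Additive Eˣ →+ (S →₀ ℤ)) (hf : Finite f.ker) :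
    ∃ (n : ℕ) (ι : Type v), 0 < n ∧
      Nonempty (Eˣ ≃* Multiplicative (ZMod n) × Multiplicative (FreeAbelianGroup ι)) := by
  set K := LinearMap.ker f.toIntLinearMap with hK
  set R := LinearMap.range f.toIntLinearMap with hR
  obtain ⟨e₁⟩ := nonempty_linearEquiv_ker_prod_range f.toIntLinearMap
  -- the kernel is finite and cyclic
  haveI : Finite K := by
    refine Finite.of_injective (fun x : K => (⟨(x : Additive Eˣ), ?_⟩ : f.ker)) ?_
    · rw [AddMonoidHom.mem_ker]
      exact x.2
    · intro x y hxy
      exact Subtype.ext (congrArg Subtype.val hxy)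
  let j : Multiplicative K →* E :=
    (Units.coeHom E).comp (AddMonoidHom.toMultiplicativeLeft K.subtype.toAddMonoidHom)
  have hj : Injective j := by
    intro x y hxy
    have h' : ((Additive.toMul ((Multiplicative.toAdd x : K) : Additive Eˣ) : Eˣ) : E) =
        ((Additive.toMul ((Multiplicative.toAdd y : K) : Additive Eˣ) : Eˣ) : E) := hxy
    have h2 := Units.val_injective h'
    have h3 : ((Multiplicative.toAdd x : K) : Additive Eˣ) = (Multiplicative.toAdd y : K) :=
      Additive.toMul.injective h2
    exact Multiplicative.toAdd.injective (Subtype.val_injective h3)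
  haveI : IsCyclic (Multiplicative K) := isCyclic_of_injective_ringHom j hj
  -- the range is free
  haveI : Module.Free ℤ R := Submodule.free_of_isPrincipalIdealRing _
  let ι := Module.Free.ChooseBasisIndex ℤ R
  let b : Module.Basis ι ℤ R := Module.Free.chooseBasis ℤ R
  refine ⟨Nat.card (Multiplicative K), ι, Nat.card_pos, ⟨?_⟩⟩
  let e : Additive Eˣ ≃+ K × (ι →₀ ℤ) :=
    (e₁.trans (LinearEquiv.prodCongr (LinearEquiv.refl ℤ K) b.repr)).toAddEquiv
  let em : Eˣ ≃* Multiplicative K × Multiplicative (ι →₀ ℤ) :=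
    (AddEquiv.toMultiplicativeRight e).trans (MulEquiv.prodMultiplicative _ _)
  exact em.trans (MulEquiv.prodCongr (zmodCyclicMulEquiv inferInstance).symm
    (AddEquiv.toMultiplicative (FreeAbelianGroup.equivFinsupp ι).symm))

end May1972

end Literature.NumberTheory.DiophantineGeometry
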